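import Mathlib.Algebra.Order.BigOperators.Group.Finset
import Mathlib.Algebra.BigOperators.Group.Finset.Powerset
import Mathlib.Tactic.Linarith
import Mathlib.Tactic.Ring
import Summits.CriticalPhenomena.PercolationContinuityZ3.Theorems.PercNearOneGluingNoHeavyLowerTailSahiCTCKleitmanWeighted
import HarnessLib

/-!
# `NoHeavyLowerTail` (crux stmt-CriticalPhenomena-4575), P3 lane: the WEIGHTED / TOP-HEAVY KLEITMAN LEMMA FOR THE TRANSFER KERNEL

Support file (seat `prim-l12-p3`, gen 33; `--supports stmt-CriticalPhenomena-4575`).  Memo `run/shared/lean/prim/prim-l12/FROM-prim-l12-p3-g33-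
DOMINANCE-MATCHING.md` §4.2 (K-top).  Setting of `…SahiCTCKleitmanSurplus` / `…SahiCTCKleitmanWeighted`: traces `tr 𝒳 D s = {U ⊆ s : D ∪ U ∈ 𝒳}`
of up-sets `𝒜, ℬ` on the sub-cube with base `D` and free set `s`; a "colouring" is a split `(U, s \ U)` of the free set, i.e. the pair of sets
`(y, z) = (D ∪ U, D ∪ (s \ U))`.  The kernel of the transfer principle / dominance-matching programme (memo §2) is
    `K(y,z) = 1[y ∈ 𝒜 ∩ ℬ]·1[z ∉ 𝒜 ∪ ℬ] − 1[y ∈ ℬ ∖ 𝒜]·1[z ∈ 𝒜 ∖ ℬ]`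
("aligned minus crossed" colourings; its sum over a 2-fibre is the Kleitman surplus, its `y ↔ z`-symmetrisation is the textbook covariance
kernel `(1_𝒜(y) − 1_𝒜(z))(1_ℬ(y) − 1_ℬ(z))`).  Observation: `K(y,z) = 1[z ∉ ℬ] · K₁(y,z)` with `K₁(y,z) = 1[y ∈ ℬ ∩ 𝒜] − 1[y ∈ ℬ]·1[z ∈ 𝒜]` the
kernel of `…SahiCTCKleitmanWeighted.sum_filter_sdiff_le_sum_inter` (rôles `𝒳 = ℬ`, `𝒵 = 𝒜`), and `U ↦ 1[D ∪ (s \ U) ∉ ℬ]` is MONOTONE in `U` (up-set `ℬ`).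
Hence, for free, THIS FILE:
* `sum_crossed_le_sum_aligned` : for every weight `φ : Finset α → ℕ` monotone under inclusion,
    `∑_{crossed U} φ U ≤ ∑_{aligned U} φ U`, crossed = `U ∈ tr ℬ ∖ tr 𝒜, s \ U ∈ tr 𝒜 ∖ tr ℬ`, aligned = `U ∈ tr 𝒜 ∩ tr ℬ, s \ U ∉ tr 𝒜 ∪ tr ℬ`
  (the WEIGHTED KLEITMAN LEMMA FOR THE TRANSFER KERNEL);
* `card_crossed_le_card_aligned_of_le` : the TOP-HEAVY version (`φ = 1[c ≤ #U]`): among the colourings whose `𝒜 ∩ ℬ`- resp. `ℬ ∖ 𝒜`-side has at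
  least `c` free points, aligned ≥ crossed ("K-top" of the memo; census-clean to n = 6, now a theorem);
* `card_crossed_le_card_aligned` : `c = 0` (the transfer-kernel form of Kleitman's lemma).
These are the counting engine behind the aligned/outer-band steps of the dominance-matching normal form (memo §3.5, §4.5).
Nothing is asserted about the crux.
-/

namespace Summit.CriticalPhenomena.PercolationContinuityZ3.Theorems.SahiCTCForms

open Finset

variable {α : Type*} [DecidableEq α]

section TransferKernel
variable {𝒜 ℬ : Finset (Finset α)}

/-- The complement-of-trace indicator `U ↦ 1[s \ U ∉ tr ℬ D s]` is monotone in `U` for an up-set `ℬ`. [this work] -/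
theorem sdiff_not_mem_tr_mono (hℬ : IsUpperSet (ℬ : Set (Finset α))) (D s : Finset α) {U U' : Finset α} (h : U ⊆ U')
    (hU : s \ U ∉ tr ℬ D s) : s \ U' ∉ tr ℬ D s := by
  intro hU'
  apply hU
  rw [mem_tr] at hU' ⊢
  refine ⟨sdiff_subset, ?_⟩
  exact hℬ (union_subset_union Subset.rfl (sdiff_subset_sdiff Subset.rfl h)) hU'.2

/-- **Weighted Kleitman lemma for the transfer kernel**: for up-sets `𝒜, ℬ`, a base `D`, a free set `s` and a weight `φ` monotone under
inclusion, the `φ`-mass of the CROSSED colourings (`D ∪ U ∈ ℬ ∖ 𝒜`, `D ∪ (s \ U) ∈ 𝒜 ∖ ℬ`) is at most the `φ`-mass of the ALIGNED colourings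
(`D ∪ U ∈ 𝒜 ∩ ℬ`, `D ∪ (s \ U) ∉ 𝒜 ∪ ℬ`).  Corollary of `sum_filter_sdiff_le_sum_inter` with the monotone weight `φ U · 1[s \ U ∉ tr ℬ D s]`. [this work] -/
theorem sum_crossed_le_sum_aligned (h𝒜 : IsUpperSet (𝒜 : Set (Finset α))) (hℬ : IsUpperSet (ℬ : Set (Finset α)))
    (D s : Finset α) (φ : Finset α → ℕ) (hφ : Monotone φ) :
    ∑ U ∈ (tr ℬ D s).filter (fun U => U ∉ tr 𝒜 D s ∧ s \ U ∈ tr 𝒜 D s ∧ s \ U ∉ tr ℬ D s), φ U ≤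
      ∑ U ∈ (tr 𝒜 D s ∩ tr ℬ D s).filter (fun U => s \ U ∉ tr 𝒜 D s ∧ s \ U ∉ tr ℬ D s), φ U := by
  classical
  -- the monotone weight ψ U = φ U · 1[s \ U ∉ tr ℬ]
  set ψ : Finset α → ℕ := fun U => if s \ U ∉ tr ℬ D s then φ U else 0 with hψ_def
  have hψ : Monotone ψ := by
    intro U U' h
    simp only [hψ_def]
    by_cases hU : s \ U ∉ tr ℬ D s
    · have hU' : s \ U' ∉ tr ℬ D s := sdiff_not_mem_tr_mono hℬ D s h hU
      rw [if_pos hU, if_pos hU']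
      exact hφ h
    · rw [if_neg hU]
      exact Nat.zero_le _
  have key := sum_filter_sdiff_le_sum_inter hℬ h𝒜 s D D ψ hψ
  -- left side of `key` = crossed part + common part; right side = aligned part + (the same) common part
  have hL : ∑ U ∈ (tr ℬ D s).filter (fun U => s \ U ∈ tr 𝒜 D s), ψ U =
      ∑ U ∈ (tr ℬ D s).filter (fun U => U ∉ tr 𝒜 D s ∧ s \ U ∈ tr 𝒜 D s ∧ s \ U ∉ tr ℬ D s), φ U +
      ∑ U ∈ (tr ℬ D s).filter (fun U => U ∈ tr 𝒜 D s ∧ s \ U ∈ tr 𝒜 D s ∧ s \ U ∉ tr ℬ D s), φ U := by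
    rw [sum_filter, sum_filter, sum_filter, ← sum_add_distrib]
    refine sum_congr rfl fun U _ => ?_
    simp only [hψ_def]
    by_cases h1 : s \ U ∈ tr 𝒜 D s <;> by_cases h2 : s \ U ∉ tr ℬ D s <;> by_cases h3 : U ∈ tr 𝒜 D s <;> simp [h1, h2, h3]
  have hR : ∑ U ∈ tr ℬ D s ∩ tr 𝒜 D s, ψ U =
      ∑ U ∈ (tr 𝒜 D s ∩ tr ℬ D s).filter (fun U => s \ U ∉ tr 𝒜 D s ∧ s \ U ∉ tr ℬ D s), φ U +
      ∑ U ∈ (tr ℬ D s).filter (fun U => U ∈ tr 𝒜 D s ∧ s \ U ∈ tr 𝒜 D s ∧ s \ U ∉ tr ℬ D s), φ U := by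
    have e1 : tr ℬ D s ∩ tr 𝒜 D s = (tr ℬ D s).filter (fun U => U ∈ tr 𝒜 D s) := by
      ext U; simp only [mem_inter, mem_filter]
    have e2 : tr 𝒜 D s ∩ tr ℬ D s = (tr ℬ D s).filter (fun U => U ∈ tr 𝒜 D s) := by
      ext U; simp only [mem_inter, mem_filter]; exact And.comm
    rw [e1, e2, filter_filter, sum_filter, sum_filter, sum_filter, ← sum_add_distrib]
    refine sum_congr rfl fun U _ => ?_
    simp only [hψ_def]
    by_cases h1 : s \ U ∈ tr 𝒜 D s <;> by_cases h2 : s \ U ∉ tr ℬ D s <;> by_cases h3 : U ∈ tr 𝒜 D s <;> simp [h1, h2, h3]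
  rw [hL, hR] at key
  linarith

/-- **Top-heavy Kleitman lemma for the transfer kernel** ("K-top" of the memo): for every threshold `c`, the crossed colourings with `c ≤ #U`
are no more than the aligned colourings with `c ≤ #U`. [this work] -/
theorem card_crossed_le_card_aligned_of_le (h𝒜 : IsUpperSet (𝒜 : Set (Finset α))) (hℬ : IsUpperSet (ℬ : Set (Finset α)))
    (D s : Finset α) (c : ℕ) :
    #((tr ℬ D s).filter fun U => U ∉ tr 𝒜 D s ∧ s \ U ∈ tr 𝒜 D s ∧ s \ U ∉ tr ℬ D s ∧ c ≤ #U) ≤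
      #((tr 𝒜 D s ∩ tr ℬ D s).filter fun U => s \ U ∉ tr 𝒜 D s ∧ s \ U ∉ tr ℬ D s ∧ c ≤ #U) := by
  have hφ : Monotone (fun U : Finset α => if c ≤ #U then 1 else 0) := by
    intro U U' h
    by_cases hc : c ≤ #U
    · have hc' : c ≤ #U' := hc.trans (card_le_card h)
      simp [hc, hc']
    · simp [hc]
  have h := sum_crossed_le_sum_aligned h𝒜 hℬ D s _ hφ
  rw [card_eq_sum_ones, card_eq_sum_ones, sum_filter, sum_filter]
  rw [sum_filter, sum_filter] at h
  have e1 : ∀ U ∈ tr ℬ D s, (if U ∉ tr 𝒜 D s ∧ s \ U ∈ tr 𝒜 D s ∧ s \ U ∉ tr ℬ D s ∧ c ≤ #U then (1:ℕ) else 0) =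
      (if U ∉ tr 𝒜 D s ∧ s \ U ∈ tr 𝒜 D s ∧ s \ U ∉ tr ℬ D s then (if c ≤ #U then 1 else 0) else 0) := by
    intro U _
    by_cases h1 : (U ∉ tr 𝒜 D s ∧ s \ U ∈ tr 𝒜 D s ∧ s \ U ∉ tr ℬ D s) <;> by_cases h2 : c ≤ #U <;> simp [h1, h2]
  have e2 : ∀ U ∈ tr 𝒜 D s ∩ tr ℬ D s, (if s \ U ∉ tr 𝒜 D s ∧ s \ U ∉ tr ℬ D s ∧ c ≤ #U then (1:ℕ) else 0) =
      (if s \ U ∉ tr 𝒜 D s ∧ s \ U ∉ tr ℬ D s then (if c ≤ #U then 1 else 0) else 0) := by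
    intro U _
    by_cases h1 : (s \ U ∉ tr 𝒜 D s ∧ s \ U ∉ tr ℬ D s) <;> by_cases h2 : c ≤ #U <;> simp [h1, h2]
  rw [sum_congr rfl e1, sum_congr rfl e2]
  exact h

/-- **Kleitman's lemma for the transfer kernel**: crossed colourings ≤ aligned colourings (the case `c = 0`; a reformulation of
`kap_nonneg` / `card_filter_sdiff_le_card_inter`). [folklore] -/
theorem card_crossed_le_card_aligned (h𝒜 : IsUpperSet (𝒜 : Set (Finset α))) (hℬ : IsUpperSet (ℬ : Set (Finset α)))
    (D s : Finset α) :
    #((tr ℬ D s).filter fun U => U ∉ tr 𝒜 D s ∧ s \ U ∈ tr 𝒜 D s ∧ s \ U ∉ tr ℬ D s) ≤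
      #((tr 𝒜 D s ∩ tr ℬ D s).filter fun U => s \ U ∉ tr 𝒜 D s ∧ s \ U ∉ tr ℬ D s) := by
  have h := sum_crossed_le_sum_aligned h𝒜 hℬ D s (fun _ => 1) (fun _ _ _ => le_rfl)
  simpa using h

end TransferKernel

end Summit.CriticalPhenomena.PercolationContinuityZ3.Theorems.SahiCTCForms
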